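import Literature.Topology.FourManifolds.SegOne
import Literature.Topology.FourManifolds.MonotoneInverse
import Literature.Topology.FourManifolds.ConnectedSumNormalForm
import HarnessLib

/-!
# The frame of the transported datum after the first conjugation

Topic `Literature/Topology/FourManifolds` (trunk T-4MAN). Fact seat
`provefact-Literature.Topology.FourManifolds.Knot.IsConnectedSum.isIsotopic` (Schubert's theorem),
geometric heart for rail knots, assembly step (3). With the data of `SegOne.lean` /
`SegOneFrame.lean` (`b, b'`, the transport `c'` of `b'`, the reference host `P`, the unit scale `U`,
thresholds, the output knot `P₁ = outOne` of the first conjugation), the **frame of `c'`** is the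
curve of the reflected output knot `R ∘ P₁` read through the inverse of the chord lift:
`F (τ) = (R ∘ P₁) (circlePt (ĝ⁻¹ τ))`. Off the image of the content of `b` under `ĝ` it is the
spiked flip frame of `(c', b')` at `u = 1`; on it, it consists of reflected chord points of `b'`
and of the reflected re-inserted unit of `b`, all closed-north points far from the bend region of
`c'`. Hence (`isWallFrame_frameC`, `isBendClear_frameC`) it is a bend-clear wall frame of `c'`.

This first part: the inverse of a lift, and the chart geometry of points near the chord of `b'`
seen from `c'` (pair scale).

Everything is proved; no named facts are introduced.

## References

* M. W. Hirsch, *Differential Topology*, Springer GTM 33 (1976), Ch. 8 §1. [HirschDT1976]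
-/

open scoped Manifold ContDiff Topology Real
open Function Set Metric Filter

noncomputable section

namespace Literature.Topology.FourManifolds

/-- Local notation: `𝔼 n` is the model Euclidean space `EuclideanSpace ℝ (Fin n)`. -/
local notation "𝔼 " n:arg => EuclideanSpace ℝ (Fin n)

/-- Local notation: `𝕊 n` is the unit sphere in `EuclideanSpace ℝ (Fin (n + 1))`. -/
local notation "𝕊 " n:arg => (Metric.sphere (0 : EuclideanSpace ℝ (Fin (n + 1))) 1)

attribute [local instance] fact_finrank_euclideanSpace_succ

open KnotsInBall ExitBend SegmentConj

/-! ### The inverse of a lift -/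

namespace IsLift

variable {g : ℝ → ℝ} (h : IsLift g)
include h

/-- **The inverse lift** `ĝ⁻¹`. [folklore] -/
def inv (_ : IsLift g) : ℝ → ℝ := invFun g

/-- `ĝ (ĝ⁻¹ y) = y`. [folklore] -/
theorem apply_inv (y : ℝ) : g (h.inv y) = y := invFun_eq (h.surjective y)

/-- `ĝ⁻¹ (ĝ t) = t`. [folklore] -/
theorem inv_apply (t : ℝ) : h.inv (g t) = t := leftInverse_invFun h.strictMono.injective t

/-- The inverse lift is smooth, with derivative the inverse of that of `ĝ`. [folklore] -/
theorem contDiffAt_inv (t : ℝ) : ContDiffAt ℝ ∞ h.inv (g t) ∧ deriv h.inv (g t) = (deriv g t)⁻¹ := by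
  have hev : ∀ᶠ x in 𝓝 t, h.inv (g x) = x := Filter.Eventually.of_forall fun x ↦ h.inv_apply x
  have hsm : ContDiffAt ℝ ∞ h.inv (g t) :=
    contDiffAt_of_eventually_leftInverse h.contDiff.contDiffAt (h.hasDerivAt t) (h.deriv_pos t).ne' (by simp) hev
  refine ⟨hsm, ?_⟩
  have hY : HasDerivAt h.inv (deriv h.inv (g t)) (g t) := (hsm.differentiableAt (by simp)).hasDerivAt
  have hcomp : HasDerivAt (fun x ↦ h.inv (g x)) (deriv h.inv (g t) * deriv g t) t := hY.comp t (h.hasDerivAt t)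
  have hid : HasDerivAt (fun x ↦ h.inv (g x)) 1 t := (hasDerivAt_id t).congr_of_eventuallyEq (hev.mono fun x hx ↦ by simp [hx])
  have := hcomp.unique hid
  field_simp [(h.deriv_pos t).ne'] at this ⊢
  linarith

/-- **The inverse of a lift is a lift.** [folklore] -/
theorem isLift_inv : IsLift h.inv where
  contDiff := contDiff_iff_contDiffAt.2 fun y ↦ by
    obtain ⟨t, rfl⟩ := h.surjective y
    exact (h.contDiffAt_inv t).1
  deriv_pos y := by
    obtain ⟨t, rfl⟩ := h.surjective y
    rw [(h.contDiffAt_inv t).2]; exact inv_pos.2 (h.deriv_pos t)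
  add_one y := by
    obtain ⟨t, rfl⟩ := h.surjective y
    rw [← h.add_one, h.inv_apply, h.inv_apply]

end IsLift

namespace BandData

/-! ### Chart geometry near the chord of the partner, seen from the transported datum -/

section NearChord

variable {A₁ B₁ K₁ A₂ B₂ K₂ : Knot} {b₁ : BandData A₁ B₁ K₁ ∅} {b₂ : BandData A₂ B₂ K₂ ∅}
  {hcross₁ : b₁.band ⁻¹' sphereEquator 2 ∩ squareNhd b₁.δ = {x ∈ squareNhd b₁.δ | x 0 = 2⁻¹}}
  {hcross₂ : b₂.band ⁻¹' sphereEquator 2 ∩ squareNhd b₂.δ = {x ∈ squareNhd b₂.δ | x 0 = 2⁻¹}}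
  {hP : IsFlipPair b₁ b₂} {κ ε₂ r₂ : ℝ} (h₂ : b₂.ArcScale hcross₂ ε₂ r₂ κ) (hT : PairScale hP hcross₂ hcross₁ κ)

include hT in
/-- **A chart point whose `b₂`-blow-up coordinates are within `1/8` of `(v, -1, 0)`, `v ∈ [5/4, 3]`,
read from `b₁` after the inversion**: first blow-up coordinate `< 3/8`, blow-up distance from the
bend centre `O = (1, 0, σ)` at least `2` (any `σ`). [folklore] -/
theorem near_chord_geometry (hκ : 0 < κ) {y : 𝔼 3} {v : ℝ} (hv : v ∈ Icc (5 / 4 : ℝ) 3)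
    (hy : ‖b₂.blowUp hcross₂ κ y - pt3 v (-1) 0‖ ≤ 1 / 8) (σ : ℝ) :
    b₁.blowUp hcross₁ κ (sphereInv y) 0 < 3 / 8 ∧ 2 ≤ ‖b₁.blowUp hcross₁ κ (sphereInv y) - cO σ‖ := by
  set Z := b₂.blowUp hcross₂ κ y with hZ
  set W := b₁.blowUp hcross₁ κ (sphereInv y) with hW
  have hZ0 : v - 1 / 8 ≤ Z 0 := by
    have hc := PiLp.norm_apply_le (Z - pt3 v (-1) 0) 0
    rw [Real.norm_eq_abs, sub_pt3_apply_zero] at hc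
    linarith [(abs_le.1 (hc.trans hy)).1]
  have hnZ : ‖Z‖ ≤ 10 := by
    have h1 : ‖Z‖ ≤ ‖Z - pt3 v (-1) 0‖ + ‖(pt3 v (-1) 0 : 𝔼 3)‖ := norm_le_norm_sub_add _ _
    have h2 : ‖(pt3 v (-1) 0 : 𝔼 3)‖ ≤ 4 := by
      have h3 : ‖(pt3 v (-1) 0 : 𝔼 3)‖ ^ 2 = v ^ 2 + 1 := by
        rw [EuclideanSpace.norm_eq, Real.sq_sqrt (by positivity), Fin.sum_univ_three]; simp
      nlinarith [norm_nonneg (pt3 v (-1) 0 : 𝔼 3), hv.1, hv.2]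
    linarith
  have e : y = b₂.blowDown hcross₂ κ Z := (b₂.blowDown_blowUp hcross₂ hκ.ne' _).symm
  have hnear : ‖W - pt3 (-Z 0) (-Z 1) (hP.mu hcross₂ hcross₁ * Z 2)‖ ≤ 1 / 32 := by
    rw [hW, e]; exact hT.near Z hnZ
  have hW0 : W 0 ≤ -Z 0 + 1 / 32 := by
    have hc := PiLp.norm_apply_le (W - pt3 (-Z 0) (-Z 1) (hP.mu hcross₂ hcross₁ * Z 2)) 0
    rw [Real.norm_eq_abs, sub_pt3_apply_zero] at hc
    linarith [(abs_le.1 (hc.trans hnear)).2]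
  refine ⟨by linarith [hv.1], ?_⟩
  have hc := PiLp.norm_apply_le (W - cO σ) 0
  rw [Real.norm_eq_abs] at hc
  have e0 : (W - cO σ) 0 = W 0 - 1 := by simp [cO]
  rw [e0] at hc
  have : 2 ≤ |W 0 - 1| := by rw [abs_of_neg (by linarith [hv.1])]; linarith [hv.1]
  exact this.trans hc

include h₂ in
/-- **Chord points are near the model line**: `‖blowUp (chordLine v) - (v, -1, 0)‖ ≤ 1/64` for
`v ∈ [5/4, 11/4]`. [folklore] -/
theorem norm_blowUp_chordLine_sub_le_arc {v : ℝ} (hv : v ∈ Icc (5 / 4 : ℝ) (11 / 4)) :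
    ‖b₂.blowUp hcross₂ κ (b₂.chordLine κ v) - pt3 v (-1) 0‖ ≤ 1 / 64 := by
  have h4 : κ * 4 < r₂ := by linarith [h₂.nine_lt_r, h₂.κ_pos]
  have := b₂.norm_blowUp_chordLine_sub_le h₂.flat h₂.κ_pos h4 hv
  linarith [h₂.eps_le]

include h₂ in
/-- **Chord points are strictly south** (`B₂` south): `‖chordLine v‖ < 2` for `v ∈ [3/2, 5/2]`.
[folklore] -/
theorem norm_chordLine_lt_two (hB₂ : B₂.InSouth) {v : ℝ} (hv : v ∈ Icc (3 / 2 : ℝ) (5 / 2)) : ‖b₂.chordLine κ v‖ < 2 := by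
  rw [← b₂.chordPiece_one_eq_chordLine hv]
  have hκ := h₂.κ_pos
  have h9 := h₂.nine_lt_half
  exact b₂.norm_chordPiece_lt_two hcross₂ hB₂ hκ (by linarith) ⟨zero_le_one, le_rfl⟩ (by linarith [hv.1])
    (by rw [abs_of_pos (by linarith [hv.1])]; nlinarith [hv.2])

include h₂ in
/-- **Near-chord chart points are nonzero** (`‖blowUp₂ y - (v, -1, 0)‖ ≤ 1/8`, `v ∈ [5/4, 3]`).
[folklore] -/
theorem ne_zero_of_blowUp_near {y : 𝔼 3} {v : ℝ} (hv : v ∈ Icc (5 / 4 : ℝ) 3)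
    (hy : ‖b₂.blowUp hcross₂ κ y - pt3 v (-1) 0‖ ≤ 1 / 8) : y ≠ 0 := by
  intro h0
  have hκ := h₂.κ_pos
  rw [h0] at hy
  -- `pZero = -κ frame (blowUp 0)`, of norm `2`, so `κ ‖frame‖ ‖blowUp 0‖ ≥ 2`
  have hbig : 2 ≤ κ * ‖((b₂.frame hcross₂ : (𝔼 3) ≃L[ℝ] 𝔼 3) : (𝔼 3) →L[ℝ] 𝔼 3)‖ * ‖b₂.blowUp hcross₂ κ 0‖ := by
    have e : b₂.pZero = -(κ • b₂.frame hcross₂ (b₂.blowUp hcross₂ κ 0)) := by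
      have := b₂.blowDown_blowUp hcross₂ hκ.ne' (0 : 𝔼 3)
      rw [blowDown] at this
      exact eq_neg_of_add_eq_zero_left this
    have hn : ‖b₂.pZero‖ = 2 := b₂.norm_pZero hcross₂
    rw [e, norm_neg, norm_smul, Real.norm_eq_abs, abs_of_pos hκ] at hn
    have := ((b₂.frame hcross₂ : (𝔼 3) ≃L[ℝ] 𝔼 3) : (𝔼 3) →L[ℝ] 𝔼 3).le_opNorm (b₂.blowUp hcross₂ κ 0)
    have h3 : κ * ‖(b₂.frame hcross₂) (b₂.blowUp hcross₂ κ 0)‖ ≤ κ * (‖((b₂.frame hcross₂ : (𝔼 3) ≃L[ℝ] 𝔼 3) : (𝔼 3) →L[ℝ] 𝔼 3)‖ * ‖b₂.blowUp hcross₂ κ 0‖) :=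
      mul_le_mul_of_nonneg_left this hκ.le
    linarith
  -- but `‖blowUp 0‖ ≤ 1/8 + ‖(v, -1, 0)‖ ≤ 5`, contradicting `9 κ ‖frame‖ ≤ 1`
  have hfs := h₂.frame_small
  have hnorm : ‖b₂.blowUp hcross₂ κ 0‖ ≤ ‖b₂.blowUp hcross₂ κ 0 - pt3 v (-1) 0‖ + ‖(pt3 v (-1) 0 : 𝔼 3)‖ := norm_le_norm_sub_add _ _
  have h2 : ‖(pt3 v (-1) 0 : 𝔼 3)‖ ≤ 4 := by
    have h3 : ‖(pt3 v (-1) 0 : 𝔼 3)‖ ^ 2 = v ^ 2 + 1 := by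
      rw [EuclideanSpace.norm_eq, Real.sq_sqrt (by positivity), Fin.sum_univ_three]; simp
    nlinarith [norm_nonneg (pt3 v (-1) 0 : 𝔼 3), hv.1, hv.2]
  have hN0 : 0 ≤ ‖((b₂.frame hcross₂ : (𝔼 3) ≃L[ℝ] 𝔼 3) : (𝔼 3) →L[ℝ] 𝔼 3)‖ := norm_nonneg _
  have h5 : ‖b₂.blowUp hcross₂ κ 0‖ ≤ 5 := by linarith
  nlinarith [mul_nonneg hκ.le hN0]

include h₂ in
/-- Chord points are nonzero chart points. [folklore] -/
theorem chordLine_ne_zero {v : ℝ} (hv : v ∈ Icc (5 / 4 : ℝ) (11 / 4)) : b₂.chordLine κ v ≠ 0 :=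
  ne_zero_of_blowUp_near h₂ ⟨hv.1, by linarith [hv.2]⟩ ((norm_blowUp_chordLine_sub_le_arc h₂ hv).trans (by norm_num))

include h₂ hT in
/-- **THE WALL GEOMETRY OF NEAR-CHORD POINTS.** If `y` is a chart point with
`‖blowUp₂ y - (v, -1, 0)‖ ≤ 1/8` for some `v ∈ [5/4, 3]` and `‖y‖ < 2`, then `x' = R (ψ⁻¹ y)` is not
the north pole, lies in the open northern hemisphere, its first `b₁`-blow-up coordinate is `< 3/8`
and its blow-up distance from the bend centre of `b₁` is `≥ 2`. [folklore] -/
theorem reflect_near_chord {y : 𝔼 3} {v : ℝ} (hv : v ∈ Icc (5 / 4 : ℝ) 3)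
    (hy : ‖b₂.blowUp hcross₂ κ y - pt3 v (-1) 0‖ ≤ 1 / 8) (hy2 : ‖y‖ < 2) (hy0 : y ≠ 0) :
    reflectLast 3 (psiN.symm y) ≠ northPole ∧
      0 < ((reflectLast 3 (psiN.symm y) : 𝕊 3) : 𝔼 4) (Fin.last 3) ∧
      b₁.blowUp hcross₁ κ (psiN (reflectLast 3 (psiN.symm y))) 0 < 3 / 8 ∧
      2 ≤ ‖b₁.blowUp hcross₁ κ (psiN (reflectLast 3 (psiN.symm y))) - cO b₁.depthSign‖ := by
  obtain ⟨hN, hchart⟩ := psiN_reflectLast_psiN_symm hy0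
  obtain ⟨h1, h2⟩ := near_chord_geometry hT h₂.κ_pos hv hy b₁.depthSign
  refine ⟨hN, ?_, by rw [hchart]; exact h1, by rw [hchart]; exact h2⟩
  rw [reflectLast_apply_last, neg_pos]
  have := (norm_psiN_lt_two_iff (psiN_symm_ne_northPole y)).1 (by rw [psiN_apply_psiN_symm]; exact hy2)
  exact this

end NearChord

/-! ### The frame of the transported datum -/

section FrameC

variable {A B K K' : Knot} {b : BandData A B K ∅} {b' : BandData A B K' ∅}
  {c' : BandData (B.map (reflectLastDiffeo 3)) (A.map (reflectLastDiffeo 3)) (K'.map (reflectLastDiffeo 3)) ∅}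
  {hcross : b.band ⁻¹' sphereEquator 2 ∩ squareNhd b.δ = {x ∈ squareNhd b.δ | x 0 = 2⁻¹}}
  {hcross' : b'.band ⁻¹' sphereEquator 2 ∩ squareNhd b'.δ = {x ∈ squareNhd b'.δ | x 0 = 2⁻¹}}
  {hcrossc : c'.band ⁻¹' sphereEquator 2 ∩ squareNhd c'.δ = {x ∈ squareNhd c'.δ | x 0 = 2⁻¹}}
  {ε r A' κ : ℝ} {P : b.HostHyp hcross ε r A' κ (1 / 2) (1 / 8)}
  {εf rf : ℝ} (hf : b.IsFlat hcross εf rf) (hεf : εf ≤ HostHyp.epsU) (hrf : 4 * κ < rf) (hκt : κ * tgtLip ≤ 1)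
  (hP : IsFlipPair c' b')
  {ε₁ r₁ A₁' κ₁ ε₂ r₂ : ℝ} (HU₁ : c'.ShrinkScaleU hcrossc ε₁ r₁ A₁' κ₁) (h₂ : b'.ArcScale hcross' ε₂ r₂ κ₁)
  (hT : PairScale hP hcross' hcrossc κ₁)
  {ε₁' r₁' : ℝ} (hf₁ : c'.IsFlat hcrossc ε₁' r₁') (hε₁ : ε₁' ≤ 1 / 100) (hr₁ : 5 * κ₁ < r₁')
  {ρ₂ R₀ lam₀ rA : ℝ} (U : P.wallRef.UnitScale ρ₂ R₀ lam₀ rA) (hρ4 : ρ₂ ≤ 1 / 4) {R₁ rc : ℝ}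
  (hfar : ∀ t ∈ Icc b.alo (b.alo + 1), t ∉ Ioo (b.strLo P.HU) (b.winHi P.HU P.hl) →
    chordH P hP HU₁ h₂ hT hf₁ hε₁ hr₁ (circlePt t) = northPole ∨
      R₁ ≤ ‖psiN (chordH P hP HU₁ h₂ hT hf₁ hε₁ hr₁ (circlePt t)) - chordO h₂‖)
  (hS : (segData P hf hεf hrf hκt hP HU₁ h₂ hT hf₁ hε₁ hr₁).Small (-ρ₂) ρ₂ R₀ R₁ rc)

namespace HostHyp

/-- **The inverse chord lift** `ĝ⁻¹`. [folklore] -/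
def liftInv (P : b.HostHyp hcross ε r A' κ (1 / 2) (1 / 8)) (HU₁ : c'.ShrinkScaleU hcrossc ε₁ r₁ A₁' κ₁) : ℝ → ℝ :=
  (b.isLift_chordLift P.HU P.hl P.hl2 HU₁).inv

/-- The inverse chord lift is a lift. [folklore] -/
theorem isLift_liftInv (P : b.HostHyp hcross ε r A' κ (1 / 2) (1 / 8)) (HU₁ : c'.ShrinkScaleU hcrossc ε₁ r₁ A₁' κ₁) :
    IsLift (liftInv P HU₁) := (b.isLift_chordLift P.HU P.hl P.hl2 HU₁).isLift_inv

/-- `ĝ (ĝ⁻¹ τ) = τ`. [folklore] -/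
theorem chordLift_liftInv (P : b.HostHyp hcross ε r A' κ (1 / 2) (1 / 8)) (HU₁ : c'.ShrinkScaleU hcrossc ε₁ r₁ A₁' κ₁) (τ : ℝ) :
    b.chordLift P.HU P.hl P.hl2 HU₁ (liftInv P HU₁ τ) = τ := (b.isLift_chordLift P.HU P.hl P.hl2 HU₁).apply_inv τ

/-- `ĝ⁻¹ (ĝ t) = t`. [folklore] -/
theorem liftInv_chordLift (P : b.HostHyp hcross ε r A' κ (1 / 2) (1 / 8)) (HU₁ : c'.ShrinkScaleU hcrossc ε₁ r₁ A₁' κ₁) (t : ℝ) :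
    liftInv P HU₁ (b.chordLift P.HU P.hl P.hl2 HU₁ t) = t := (b.isLift_chordLift P.HU P.hl P.hl2 HU₁).inv_apply t

end HostHyp

namespace WallRef.UnitScale

open HostHyp

/-- **The reflected output knot** `R ∘ P₁`. [folklore] -/
def outOneR : Knot := (U.outOne (segData P hf hεf hrf hκt hP HU₁ h₂ hT hf₁ hε₁ hr₁) rfl rfl rfl rfl (Psi_wallRef_host P hf hεf hrf hκt hP HU₁ h₂ hT hf₁ hε₁ hr₁) hρ4 hfar hS).map (reflectLastDiffeo 3)

/-- **THE FRAME OF THE TRANSPORTED DATUM**: the curve of `R ∘ P₁` through the inverse chord lift.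
[folklore] -/
def frameC (τ : ℝ) : 𝔼 4 := Knot.curve (U.outOneR hf hεf hrf hκt hP HU₁ h₂ hT hf₁ hε₁ hr₁ hρ4 hfar hS) (liftInv P HU₁ τ)

/-- The frame as a reflected output point. [folklore] -/
theorem frameC_eq (τ : ℝ) : U.frameC hf hεf hrf hκt hP HU₁ h₂ hT hf₁ hε₁ hr₁ hρ4 hfar hS τ =
    ((reflectLast 3 (U.outOne (segData P hf hεf hrf hκt hP HU₁ h₂ hT hf₁ hε₁ hr₁) rfl rfl rfl rfl (Psi_wallRef_host P hf hεf hrf hκt hP HU₁ h₂ hT hf₁ hε₁ hr₁) hρ4 hfar hS (circlePt (liftInv P HU₁ τ))) : 𝕊 3) : 𝔼 4) := by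
  rw [frameC, Knot.curve_apply, outOneR, SphereEmbedding.map_apply, coe_reflectLastDiffeo]

/-- The frame at a lifted parameter: `F (ĝ t) = R (P₁ (circlePt t))`. [folklore] -/
theorem frameC_chordLift (t : ℝ) : U.frameC hf hεf hrf hκt hP HU₁ h₂ hT hf₁ hε₁ hr₁ hρ4 hfar hS (b.chordLift P.HU P.hl P.hl2 HU₁ t) =
    ((reflectLast 3 (U.outOne (segData P hf hεf hrf hκt hP HU₁ h₂ hT hf₁ hε₁ hr₁) rfl rfl rfl rfl (Psi_wallRef_host P hf hεf hrf hκt hP HU₁ h₂ hT hf₁ hε₁ hr₁) hρ4 hfar hS (circlePt t)) : 𝕊 3) : 𝔼 4) := by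
  rw [frameC_eq, liftInv_chordLift]

/-- The frame is `C^∞`. [folklore] -/
theorem contDiff_frameC : ContDiff ℝ ∞ (U.frameC hf hεf hrf hκt hP HU₁ h₂ hT hf₁ hε₁ hr₁ hρ4 hfar hS) :=
  (Knot.contDiff_curve _).comp (isLift_liftInv P HU₁).contDiff

/-- The frame is `1`-periodic. [folklore] -/
theorem periodic_frameC : Periodic (U.frameC hf hεf hrf hκt hP HU₁ h₂ hT hf₁ hε₁ hr₁ hρ4 hfar hS) 1 := fun τ ↦ by
  simp only [frameC]; rw [(isLift_liftInv P HU₁).add_one, Knot.periodic_curve]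

/-- The frame is a regular loop. [folklore] -/
theorem isRegularLoop_frameC : IsRegularLoop (U.frameC hf hεf hrf hκt hP HU₁ h₂ hT hf₁ hε₁ hr₁ hρ4 hfar hS) :=
  (Knot.isRegularLoop_curve _).comp_lift (isLift_liftInv P HU₁)

/-- The frame is injective on every fundamental domain. [folklore] -/
theorem injOn_frameC (a : ℝ) : InjOn (U.frameC hf hεf hrf hκt hP HU₁ h₂ hT hf₁ hε₁ hr₁ hρ4 hfar hS) (Ico a (a + 1)) := by
  intro τ₁ h₁ τ₂ h₂' he
  simp only [frameC] at he
  obtain ⟨m, hm⟩ := (Knot.curve_eq_curve_iff _).1 he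
  -- `ĝ⁻¹ τ₁ = ĝ⁻¹ τ₂ + m`, so `τ₁ = τ₂ + m`
  have hL := isLift_liftInv P HU₁
  have h3 : liftInv P HU₁ τ₁ = liftInv P HU₁ (τ₂ + m) := by rw [hL.add_int]; exact hm
  have h4 : τ₁ = τ₂ + m := hL.strictMono.injective h3
  have h5 : (m : ℝ) < 1 := by linarith [h₁.2, h₂'.1]
  have h6 : (-1 : ℝ) < m := by linarith [h₁.1, h₂'.2]
  have h5' : m < 1 := by exact_mod_cast h5
  have h6' : -1 < m := by exact_mod_cast h6
  obtain rfl : m = 0 := by omega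
  simpa using h4

/-! ### The frame off the image of the content of `b` -/

/-- **Off the content of `b` the output knot, reflected, is the flip knot at the lifted parameter.**
[folklore] -/
theorem reflect_outOne_of_not_mem {t : ℝ} (ht : t ∈ Ico b.alo (b.alo + 1))
    (hts : t ∉ b.contentSet P.HU.cone.spike.κ_pos P.HU.cone.spike.seven_le_gapLo P.HU.cone.spike.seven_le_gapHi) :
    reflectLast 3 (U.outOne (segData P hf hεf hrf hκt hP HU₁ h₂ hT hf₁ hε₁ hr₁) rfl rfl rfl rfl (Psi_wallRef_host P hf hεf hrf hκt hP HU₁ h₂ hT hf₁ hε₁ hr₁) hρ4 hfar hS (circlePt t)) =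
      flipKnot h₂ hT HU₁.cone hf₁ hε₁ hr₁ (transport_hemispheres P.hA P.hB).1 (transport_hemispheres P.hA P.hB).2.1
        (transport_hemispheres P.hA P.hB).2.2 P.hB (u := 1) ⟨zero_le_one, le_rfl⟩ (circlePt (b.chordLift P.HU P.hl P.hl2 HU₁ t)) := by
  have hwin : t ∉ Icc (U.w₁ hρ4) (U.w₂ hρ4) := fun h ↦ hts (by
    obtain ⟨m1, -, -, -, -, m6⟩ := U.window_marks hρ4
    exact ⟨by linarith [h.1], by linarith [h.2]⟩)
  rw [U.outOne_circlePt_of_not_mem (segData P hf hεf hrf hκt hP HU₁ h₂ hT hf₁ hε₁ hr₁) rfl rfl rfl rfl (Psi_wallRef_host P hf hεf hrf hκt hP HU₁ h₂ hT hf₁ hε₁ hr₁) hρ4 hfar hS ht hwin,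
    P.wallRef.bent_of_not_mem U.hl₀ U.hrA ht hts, HostHyp.wallRef_host P, segData_Ψ, Psi_host, chordH, b.chordHost_circlePt, reflectLast_reflectLast]

/-- **The frame off the image of the content**: if every representative of `ĝ⁻¹ τ` in the
fundamental domain of `b` is off the content of `b`, then `F τ` is the spiked flip frame of
`(c', b')` at `u = 1` (periodised). [folklore] -/
theorem frameC_eq_periodise {τ : ℝ}
    (h : ∀ m : ℤ, liftInv P HU₁ τ - m ∈ Ico b.alo (b.alo + 1) →
      liftInv P HU₁ τ - m ∉ b.contentSet P.HU.cone.spike.κ_pos P.HU.cone.spike.seven_le_gapLo P.HU.cone.spike.seven_le_gapHi) :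
    U.frameC hf hεf hrf hκt hP HU₁ h₂ hT hf₁ hε₁ hr₁ hρ4 hfar hS τ = periodise c'.alo (flipSpikedC h₂ HU₁.cone 1) τ := by
  set t := liftInv P HU₁ τ with ht
  obtain ⟨m, hm⟩ := exists_toIcoMod_one_eq b.alo t
  have ht' : t - m ∈ Ico b.alo (b.alo + 1) := by rw [← hm]; exact toIcoMod_one_mem b.alo t
  have hc := h m ht'
  have e1 : circlePt t = circlePt (t - m) := by
    rw [show t - (m : ℝ) = t + ((-m : ℤ) : ℝ) by push_cast; ring, circlePt_add_int]
  have e2 : b.chordLift P.HU P.hl P.hl2 HU₁ (t - m) = τ - m := by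
    rw [show t - (m : ℝ) = t + ((-m : ℤ) : ℝ) by push_cast; ring, (b.isLift_chordLift P.HU P.hl P.hl2 HU₁).add_int, ht,
      chordLift_liftInv]; push_cast; ring
  have e3 : circlePt (τ - m) = circlePt τ := by
    rw [show τ - (m : ℝ) = τ + ((-m : ℤ) : ℝ) by push_cast; ring, circlePt_add_int]
  rw [frameC_eq, ← ht, e1, U.reflect_outOne_of_not_mem hf hεf hrf hκt hP HU₁ h₂ hT hf₁ hε₁ hr₁ hρ4 hfar hS ht' hc, e2, e3,
    coe_flipKnot_circlePt]

/-- **The image of the content of `b` lies in the chord zone of `c'`**: for a content parameter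
`t` of `b`, `ĝ t` is in the upper core of `c'` with `αHi' (ĝ t) ∈ [-7/3, -5/3]`. [folklore] -/
theorem chordLift_mem_of_mem (P : b.HostHyp hcross ε r A' κ (1 / 2) (1 / 8)) (HU₁ : c'.ShrinkScaleU hcrossc ε₁ r₁ A₁' κ₁) {t : ℝ}
    (hts : t ∈ b.contentSet P.HU.cone.spike.κ_pos P.HU.cone.spike.seven_le_gapLo P.HU.cone.spike.seven_le_gapHi) :
    b.chordLift P.HU P.hl P.hl2 HU₁ t ∈ Icc (c'.tcHi - c'.epsHi / 8) (c'.tcHi + c'.epsHi / 8) ∧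
      c'.alphaHi κ₁ (b.chordLift P.HU P.hl P.hl2 HU₁ t) ∈ Icc (-(7 / 3) : ℝ) (-(5 / 3)) := by
  obtain ⟨z1, z2, z3, z4, z5, z6⟩ := P.wallRef.content_marks
  obtain ⟨m1, m2, m3, m3', m4, m5⟩ := b.str_marks P.HU P.hl
  have hjl := b.juncLo_mem_core P.HU.cone.spike.κ_pos P.HU.cone.spike.seven_le_gapLo
  have hwj := P.wallRef.winHi_le_jHi
  have hsl : b.strLo P.HU ≤ b.juncLo P.HU.cone.spike.κ_pos P.HU.cone.spike.seven_le_gapLo := by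
    -- `αLo strLo = 1/4 < 3/8 = αLo juncLo`
    have hκ := P.HU.cone.spike.κ_pos
    obtain ⟨-, hjlv⟩ := b.juncLo_spec hκ P.HU.cone.spike.seven_le_gapLo
    by_contra hlt; push Not at hlt
    have := (b.strictMonoOn_alphaLo hκ) hjl (b.parLo_mem_core hκ P.HU.cone.spike.seven_le_gapLo quarter_mem7) hlt
    rw [hjlv, b.alphaLo_parLo hκ P.HU.cone.spike.seven_le_gapLo quarter_mem7] at this; norm_num at this
  have hsh : b.juncHi P.HU.cone.spike.κ_pos P.HU.cone.spike.seven_le_gapHi ≤ b.strHi P.HU := by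
    have hκ := P.HU.cone.spike.κ_pos
    obtain ⟨hjh, hjhv⟩ := b.juncHi_spec hκ P.HU.cone.spike.seven_le_gapHi
    by_contra hlt; push Not at hlt
    have := (b.strictAntiOn_alphaHi hκ) (b.parHi_mem_core hκ P.HU.cone.spike.seven_le_gapHi quarter_mem7) ⟨hjh.1, by linarith [hjh.2, b.epsHi_bounds.1]⟩ hlt
    rw [hjhv, b.alphaHi_parHi hκ P.HU.cone.spike.seven_le_gapHi quarter_mem7] at this
    norm_num at this
  have hmem : t ∈ Icc (b.strLo P.HU) (b.strHi P.HU) := ⟨hsl.trans hts.1, hts.2.trans hsh⟩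
  have hz : t ∈ Ioo (b.zoneLo P.HU) (b.zoneHi P.HU) := ⟨by linarith [hmem.1], by linarith [hmem.2]⟩
  obtain ⟨-, hcore, hα⟩ := b.chordPar_zone P.HU P.hl P.hl2 HU₁ hz
  have hcl := b.clockFn_str P.HU P.hl P.hl2 hmem
  rw [b.chordLift_of_mem P.HU P.hl P.hl2 HU₁ hmem]
  refine ⟨hcore, ?_⟩
  rw [hα, chordLev]
  constructor <;> linarith [hcl.1, hcl.2]

/-- **Chord-zone parameters lie strictly inside the fundamental domain of `c'`, right of the
native zone.** [folklore] -/
theorem chordZone_marks {τ : ℝ} (hτ : τ ∈ Icc (c'.tcHi - c'.epsHi / 8) (c'.tcHi + c'.epsHi / 8))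
    (hα : c'.alphaHi κ₁ τ ∈ Icc (-(7 / 3) : ℝ) (-(5 / 3))) :
    τ ∈ Ioo c'.alo (c'.alo + 1) ∧ c'.parHi HU₁.cone.spike.κ_pos HU₁.cone.spike.seven_le_gapHi neg_five_quarters_mem < τ ∧
      τ ∉ c'.contentSet HU₁.cone.spike.κ_pos HU₁.cone.spike.seven_le_gapLo HU₁.cone.spike.seven_le_gapHi := by
  have h1 := HU₁.cone.spike
  have hκ₁ := h1.κ_pos
  have hcm := c'.core_marks
  have hε := c'.epsLo_bounds.1
  have hε' := c'.epsHi_bounds.1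
  refine ⟨⟨by linarith [hτ.1, hcm.1, hcm.2.1], by linarith [hτ.2]⟩,
    (c'.alphaHi_lt_iff' hκ₁ h1.seven_le_gapHi neg_five_quarters_mem hτ).1 (by linarith [hα.2]), fun hc ↦ ?_⟩
  obtain ⟨hjh, hjhv⟩ := c'.juncHi_spec hκ₁ h1.seven_le_gapHi
  have hle : τ ≤ c'.juncHi hκ₁ h1.seven_le_gapHi := hc.2
  have := (c'.strictAntiOn_alphaHi hκ₁).antitoneOn hτ ⟨hjh.1, by linarith [hjh.2]⟩ hle
  rw [hjhv] at this; linarith [hα.2]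

/-- **THE DICHOTOMY**: for `τ` in the fundamental domain of `c'`, either every representative of
`ĝ⁻¹ τ` is off the content of `b` (so `F τ` is the flip frame), or `ĝ⁻¹ τ` itself is a content
parameter of `b` in its fundamental domain and `τ = ĝ (ĝ⁻¹ τ)` lies in the chord zone. [folklore] -/
theorem dichotomy (P : b.HostHyp hcross ε r A' κ (1 / 2) (1 / 8)) (HU₁ : c'.ShrinkScaleU hcrossc ε₁ r₁ A₁' κ₁) {τ : ℝ}
    (hτ : τ ∈ Ico c'.alo (c'.alo + 1)) :
    (∀ m : ℤ, liftInv P HU₁ τ - m ∈ Ico b.alo (b.alo + 1) →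
      liftInv P HU₁ τ - m ∉ b.contentSet P.HU.cone.spike.κ_pos P.HU.cone.spike.seven_le_gapLo P.HU.cone.spike.seven_le_gapHi) ∨
    (liftInv P HU₁ τ ∈ Ico b.alo (b.alo + 1) ∧
      liftInv P HU₁ τ ∈ b.contentSet P.HU.cone.spike.κ_pos P.HU.cone.spike.seven_le_gapLo P.HU.cone.spike.seven_le_gapHi) := by
  by_cases h : ∀ m : ℤ, liftInv P HU₁ τ - m ∈ Ico b.alo (b.alo + 1) →
      liftInv P HU₁ τ - m ∉ b.contentSet P.HU.cone.spike.κ_pos P.HU.cone.spike.seven_le_gapLo P.HU.cone.spike.seven_le_gapHi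
  · exact Or.inl h
  · right
    push Not at h
    obtain ⟨m, hm, hc⟩ := h
    set t := liftInv P HU₁ τ with ht
    obtain ⟨hcore, hα⟩ := chordLift_mem_of_mem P HU₁ hc
    obtain ⟨hIoo, -, -⟩ := chordZone_marks HU₁ hcore hα
    have e2 : b.chordLift P.HU P.hl P.hl2 HU₁ (t - m) = τ - m := by
      rw [show t - (m : ℝ) = t + ((-m : ℤ) : ℝ) by push_cast; ring, (b.isLift_chordLift P.HU P.hl P.hl2 HU₁).add_int, ht,
        chordLift_liftInv]; push_cast; ring
    rw [e2] at hIoo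
    have h5 : (m : ℝ) < 1 := by linarith [hτ.2, hIoo.1]
    have h6 : (-1 : ℝ) < m := by linarith [hτ.1, hIoo.2]
    have h5' : m < 1 := by exact_mod_cast h5
    have h6' : -1 < m := by exact_mod_cast h6
    obtain rfl : m = 0 := by omega
    simp only [Int.cast_zero, sub_zero] at hm hc
    exact ⟨hm, hc⟩

/-! ### The frame on the image of the content of `b`: near-chord points -/

/-- **THE OUTPUT KNOT ON THE CONTENT OF `b` CONSISTS OF NEAR-CHORD POINTS**: chord points of `b'`
(clocks in `[-1, 1]`, levels `[5/3, 7/3]`) or re-inserted unit points (within `‖L‖ R₀` of the chord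
centre), granted `‖frame'⁻¹‖ ‖L‖ R₀ ≤ κ₁ / 16` and `‖o'‖ + ‖L‖ R₀ < 2`. [folklore] -/
theorem outOne_content
    (hL1 : ‖(((b'.frame hcross').symm : (𝔼 3) ≃L[ℝ] 𝔼 3) : (𝔼 3) →L[ℝ] 𝔼 3)‖ *
      (‖(((segData P hf hεf hrf hκt hP HU₁ h₂ hT hf₁ hε₁ hr₁).L : (𝔼 3) ≃L[ℝ] 𝔼 3) : (𝔼 3) →L[ℝ] 𝔼 3)‖ * R₀) ≤ κ₁ / 16)
    (hL2 : ‖chordO h₂‖ + ‖(((segData P hf hεf hrf hκt hP HU₁ h₂ hT hf₁ hε₁ hr₁).L : (𝔼 3) ≃L[ℝ] 𝔼 3) : (𝔼 3) →L[ℝ] 𝔼 3)‖ * R₀ < 2)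
    {t : ℝ} (ht : t ∈ Ico b.alo (b.alo + 1))
    (hc : t ∈ b.contentSet P.HU.cone.spike.κ_pos P.HU.cone.spike.seven_le_gapLo P.HU.cone.spike.seven_le_gapHi) :
    ∃ y : 𝔼 3, ∃ v ∈ Icc (5 / 4 : ℝ) 3, ‖b'.blowUp hcross' κ₁ y - pt3 v (-1) 0‖ ≤ 1 / 8 ∧ ‖y‖ < 2 ∧
      U.outOne (segData P hf hεf hrf hκt hP HU₁ h₂ hT hf₁ hε₁ hr₁) rfl rfl rfl rfl (Psi_wallRef_host P hf hεf hrf hκt hP HU₁ h₂ hT hf₁ hε₁ hr₁) hρ4 hfar hS (circlePt t) = psiN.symm y := by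
  set D := segData P hf hεf hrf hκt hP HU₁ h₂ hT hf₁ hε₁ hr₁ with hD
  have h := P.HU.cone.spike
  have hκ := h.κ_pos
  have hκ₁ := h₂.κ_pos
  have hρ := U.ρ₂_pos
  obtain ⟨z1, z2, z3, z4, z5, z6⟩ := P.wallRef.content_marks
  obtain ⟨m1, m2, m3, m3', m4, m5⟩ := b.str_marks P.HU P.hl
  obtain ⟨cw₁, aw₁⟩ := P.wallRef.lowPar_core (U.mem_two hρ4)
  obtain ⟨cw₂, aw₂⟩ := P.wallRef.upPar_core (U.mem_two hρ4)
  have vw₁ := (P.wallRef.lowPar_spec (U.mem_two hρ4)).2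
  have vw₂ := (P.wallRef.upPar_spec (U.mem_two hρ4)).2
  obtain ⟨hjl, hjlv⟩ := b.juncLo_spec hκ h.seven_le_gapLo
  obtain ⟨hjh, hjhv⟩ := b.juncHi_spec hκ h.seven_le_gapHi
  have hjlc : b.juncLo hκ h.seven_le_gapLo ∈ Icc (b.tcLo - b.epsLo / 8) (b.tcLo + b.epsLo / 8) := ⟨by linarith [hjl.1, b.epsLo_bounds.1], hjl.2⟩
  have hjhc : b.juncHi hκ h.seven_le_gapHi ∈ Icc (b.tcHi - b.epsHi / 8) (b.tcHi + b.epsHi / 8) := ⟨hjh.1, by linarith [hjh.2, b.epsHi_bounds.1]⟩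
  have hc' : b.juncLo hκ h.seven_le_gapLo ≤ t ∧ t ≤ b.juncHi hκ h.seven_le_gapHi := hc
  -- chord points: `o' + ρ d' = chordLine (2 + ρ/3)` with `ρ ∈ [-1, 1]`
  have chord : ∀ ρ ∈ Icc (-1 : ℝ) 1, ∃ v ∈ Icc (5 / 4 : ℝ) 3, ‖b'.blowUp hcross' κ₁ (chordO h₂ + ρ • chordD h₂) - pt3 v (-1) 0‖ ≤ 1 / 8 ∧
      ‖chordO h₂ + ρ • chordD h₂‖ < 2 := by
    intro ρ hρ'
    refine ⟨2 + ρ / 3, ⟨by linarith [hρ'.1], by linarith [hρ'.2]⟩, ?_, ?_⟩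
    · rw [← chordLine_chordLev]
      exact (norm_blowUp_chordLine_sub_le_arc h₂ ⟨by linarith [hρ'.1], by linarith [hρ'.2]⟩).trans (by norm_num)
    · rw [← chordLine_chordLev]
      exact norm_chordLine_lt_two h₂ P.hB ⟨by linarith [hρ'.1], by linarith [hρ'.2]⟩
  -- the segment is carried clock for clock
  have seg : ∀ ρ ∈ Icc (-1 : ℝ) (1 / 2), stageOne (segData P hf hεf hrf hκt hP HU₁ h₂ hT hf₁ hε₁ hr₁).Ψ (psiN.symm (P.wallRef.segO + ρ • P.wallRef.segD)) =
      psiN.symm (chordO h₂ + ρ • chordD h₂) := fun ρ hρ' ↦ D.seg ρ hρ'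
  by_cases hw : t ∈ Icc (U.w₁ hρ4) (U.w₂ hρ4)
  · -- on the window: the re-inserted unit
    have hP₁ : U.outOne (segData P hf hεf hrf hκt hP HU₁ h₂ hT hf₁ hε₁ hr₁) rfl rfl rfl rfl (Psi_wallRef_host P hf hεf hrf hκt hP HU₁ h₂ hT hf₁ hε₁ hr₁) hρ4 hfar hS (circlePt t) =
        psiN.symm (D.A (psiN (P.wallRef.bent U.hl₀ U.hrA (circlePt t)))) :=
      Subtype.ext (U.coe_outOne_circlePt_of_mem (segData P hf hεf hrf hκt hP HU₁ h₂ hT hf₁ hε₁ hr₁) rfl rfl rfl rfl (Psi_wallRef_host P hf hεf hrf hκt hP HU₁ h₂ hT hf₁ hε₁ hr₁) hρ4 hfar hS hw)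
    rcases U.inner hρ4 hw with ⟨ρ', hρ', he⟩ | ⟨y₀, hy₀, he⟩
    · -- a segment point of the unit window: a chord point
      have hb : P.wallRef.bent U.hl₀ U.hrA (circlePt t) = psiN.symm (P.wallRef.segO + ρ' • P.wallRef.segD) := Subtype.ext (by rw [← he, Knot.curve_apply])
      have hA : D.A (psiN (P.wallRef.bent U.hl₀ U.hrA (circlePt t))) = chordO h₂ + ρ' • chordD h₂ := by
        rw [hb, psiN_apply_psiN_symm, SegData.A]
        show D.o' + D.L (P.wallRef.segO + ρ' • P.wallRef.segD - D.o) = chordO h₂ + ρ' • chordD h₂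
        rw [show D.o = P.wallRef.segO from rfl, show D.o' = chordO h₂ from rfl, add_sub_cancel_left, map_smul,
          show P.wallRef.segD = D.d from rfl, D.L_d]
        rfl
      obtain ⟨v, hv, h1, h2'⟩ := chord ρ' ⟨by linarith [hρ'.1], by linarith [hρ'.2]⟩
      exact ⟨_, v, hv, h1, h2', by rw [hP₁, hA]⟩
    · -- a unit point: within `‖L‖ R₀` of the chord centre
      have hb : P.wallRef.bent U.hl₀ U.hrA (circlePt t) = psiN.symm y₀ := Subtype.ext (by rw [← he, Knot.curve_apply])
      set NL := ‖((D.L : (𝔼 3) ≃L[ℝ] 𝔼 3) : (𝔼 3) →L[ℝ] 𝔼 3)‖ with hNL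
      set NF := ‖(((b'.frame hcross').symm : (𝔼 3) ≃L[ℝ] 𝔼 3) : (𝔼 3) →L[ℝ] 𝔼 3)‖ with hNF
      have hNL0 : 0 ≤ NL := norm_nonneg _
      have hNF0 : 0 ≤ NF := norm_nonneg _
      set y := D.A y₀ with hy
      have hdist : ‖y - chordO h₂‖ ≤ NL * R₀ := by
        have e : y - chordO h₂ = D.L (y₀ - P.wallRef.segO) := by
          rw [hy, SegData.A, show D.o' = chordO h₂ from rfl, show D.o = P.wallRef.segO from rfl, add_sub_cancel_left]
        rw [e]
        refine (((D.L : (𝔼 3) ≃L[ℝ] 𝔼 3) : (𝔼 3) →L[ℝ] 𝔼 3).le_opNorm _).trans ?_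
        exact mul_le_mul_of_nonneg_left (by rw [← dist_eq_norm]; exact mem_closedBall.1 hy₀) hNL0
      refine ⟨y, 2, ⟨by norm_num, by norm_num⟩, ?_, ?_, by rw [hP₁, hb, psiN_apply_psiN_symm]⟩
      · -- blow-up: within `NF NL R₀ / κ₁ + 1/64 ≤ 1/8` of `(2, -1, 0)`
        have e : b'.blowUp hcross' κ₁ y - pt3 2 (-1) 0 =
            κ₁⁻¹ • ((b'.frame hcross').symm (y - chordO h₂)) + (b'.blowUp hcross' κ₁ (chordO h₂) - pt3 2 (-1) 0) := by
          simp only [blowUp, map_sub, smul_sub]; abel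
        rw [e]
        refine (norm_add_le _ _).trans ?_
        have h1 : ‖κ₁⁻¹ • ((b'.frame hcross').symm (y - chordO h₂))‖ ≤ 1 / 16 := by
          rw [norm_smul, Real.norm_eq_abs, abs_of_pos (inv_pos.2 hκ₁)]
          have := ((((b'.frame hcross').symm : (𝔼 3) ≃L[ℝ] 𝔼 3) : (𝔼 3) →L[ℝ] 𝔼 3)).le_opNorm (y - chordO h₂)
          have h3 : NF * ‖y - chordO h₂‖ ≤ NF * (NL * R₀) := mul_le_mul_of_nonneg_left hdist hNF0
          rw [inv_mul_le_iff₀ hκ₁]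
          have h4 : ‖((b'.frame hcross').symm : (𝔼 3) ≃L[ℝ] 𝔼 3) (y - chordO h₂)‖ ≤ NF * ‖y - chordO h₂‖ := this
          linarith
        have h2' : ‖b'.blowUp hcross' κ₁ (chordO h₂) - pt3 2 (-1) 0‖ ≤ 1 / 64 :=
          norm_blowUp_chordLine_sub_le_arc h₂ ⟨by norm_num, by norm_num⟩
        linarith
      · have := norm_le_norm_sub_add y (chordO h₂)
        have h3 : ‖y‖ ≤ ‖chordO h₂‖ + NL * R₀ := by
          have := norm_add_le (y - chordO h₂) (chordO h₂)
          rw [sub_add_cancel] at this; linarith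
        linarith
  · -- off the window: `Ψ₁ (bent)`, a chord point
    have hP₁ := U.outOne_circlePt_of_not_mem (segData P hf hεf hrf hκt hP HU₁ h₂ hT hf₁ hε₁ hr₁) rfl rfl rfl rfl (Psi_wallRef_host P hf hεf hrf hκt hP HU₁ h₂ hT hf₁ hε₁ hr₁) hρ4 hfar hS ht hw
    rcases lt_or_ge t (P.wallRef.lowPar (U.mem_two hρ4)) with h1 | h1
    · -- lower ray below the window
      have hcore : t ∈ Icc (b.tcLo - b.epsLo / 8) (b.tcLo + b.epsLo / 8) := ⟨by linarith [hjlc.1], by linarith [cw₁.2]⟩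
      have hα : b.alphaLo κ t ∈ Icc (3 / 8 : ℝ) (3 / 4) :=
        ⟨by rw [← hjlv]; exact (b.strictMonoOn_alphaLo hκ).monotoneOn hjlc hcore hc'.1,
          ((b.strictMonoOn_alphaLo hκ).monotoneOn hcore cw₁ h1.le).trans aw₁.2⟩
      have hψ := psiLo_mem_of_alphaLo U.hl₀ hα
      obtain ⟨v, hv, e1, e2⟩ := chord (-b.psiLo κ lam₀ t) ⟨by linarith [hψ.2], by linarith [hψ.1, U.hl₀.1]⟩
      refine ⟨_, v, hv, e1, e2, ?_⟩
      rw [hP₁, P.wallRef.bent_lowerStraight U.hl₀ U.hrA hcore ⟨by linarith [hα.1], hα.2⟩,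
        seg _ ⟨by linarith [hψ.2], by linarith [hψ.1, U.hl₀.1]⟩]
    · have hw' : P.wallRef.upPar (U.mem_two hρ4) < t := by
        by_contra hle; push Not at hle; exact hw ⟨h1, hle⟩
      have hcore : t ∈ Icc (b.tcHi - b.epsHi / 8) (b.tcHi + b.epsHi / 8) := ⟨by linarith [cw₂.1], by linarith [hjhc.2]⟩
      have hα : b.alphaHi κ t ∈ Icc (3 / 8 : ℝ) (3 / 4) :=
        ⟨by rw [← hjhv]; exact (b.strictAntiOn_alphaHi hκ).antitoneOn hcore hjhc hc'.2,
          ((b.strictAntiOn_alphaHi hκ).antitoneOn cw₂ hcore hw'.le).trans aw₂.2⟩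
      have hψ := psiHi_mem_of_alphaHi U.hl₀ hα
      have hlt := psiHi_lt_psiHi_of_lt U.hl₀ hκ cw₂ hcore hw' (by linarith [aw₂.2])
      rcases le_or_gt (b.psiHi κ lam₀ t) (1 / 2) with h3 | h3
      · -- upper bent segment
        obtain ⟨v, hv, e1, e2⟩ := chord (b.psiHi κ lam₀ t) ⟨by linarith [hψ.1, U.hl₀.1], by linarith⟩
        refine ⟨_, v, hv, e1, e2, ?_⟩
        rw [hP₁, P.wallRef.bent_upperStraight U.hl₀ U.hrA U.hrA8 hcore hα ⟨by linarith [U.rA_le], h3⟩,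
          seg _ ⟨by linarith [hψ.1, U.hl₀.1], h3⟩]
      · -- the spiral: a reference host point of the straight parameters
        obtain ⟨t', ht', he⟩ := P.wallRef.bent_spiral U.hl₀ U.hrA U.hrA8 hcore hα h3.le
        have hmem : t' ∈ Icc (b.strLo P.HU) (b.strHi P.HU) := by
          obtain ⟨-, hsh⟩ := (chordLift_mem_of_mem P HU₁ (t := b.juncHi hκ h.seven_le_gapHi) ⟨by linarith, le_rfl⟩)
          -- `strLo < winHi ≤ t' ≤ juncHi ≤ strHi`
          have hww : b.winLo P.HU P.hl < b.winHi P.HU P.hl := by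
            linarith [b.winLo_lt_collarLo P.HU P.hl P.hl2, b.collarLo_lt_collarHi P.HU P.hl P.hl2, b.collarHi_lt_winHi P.HU P.hl P.hl2]
          refine ⟨by linarith [ht'.1], ?_⟩
          -- `juncHi ≤ strHi`: `αHi juncHi = 3/8 > 1/4 = αHi strHi`
          by_contra hlt'; push Not at hlt'
          have h4 := (b.strictAntiOn_alphaHi hκ) (b.parHi_mem_core hκ h.seven_le_gapHi quarter_mem7) ⟨hjh.1, by linarith [hjh.2, b.epsHi_bounds.1]⟩
            (lt_of_lt_of_le hlt' ht'.2)
          rw [hjhv, b.alphaHi_parHi hκ h.seven_le_gapHi quarter_mem7] at h4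
          norm_num at h4
        have hcl := b.clockFn_str P.HU P.hl P.hl2 hmem
        obtain ⟨v, hv, e1, e2⟩ := chord (b.clockFn P.HU P.hl P.hl2 t') hcl
        refine ⟨_, v, hv, e1, e2, ?_⟩
        rw [hP₁, he, HostHyp.wallRef_host P, segData_Ψ, Psi_host, chordH, b.chordHost_circlePt_of_mem P.HU P.hl P.hl2 HU₁ h₂ hP hT hf₁ hε₁ hr₁ _ _ _ _ hmem]

/-- **THE FRAME OF THE TRANSPORTED DATUM IS A WALL FRAME OF `c'`.** [folklore] -/
theorem isWallFrame_frameC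
    (hL1 : ‖(((b'.frame hcross').symm : (𝔼 3) ≃L[ℝ] 𝔼 3) : (𝔼 3) →L[ℝ] 𝔼 3)‖ *
      (‖(((segData P hf hεf hrf hκt hP HU₁ h₂ hT hf₁ hε₁ hr₁).L : (𝔼 3) ≃L[ℝ] 𝔼 3) : (𝔼 3) →L[ℝ] 𝔼 3)‖ * R₀) ≤ κ₁ / 16)
    (hL2 : ‖chordO h₂‖ + ‖(((segData P hf hεf hrf hκt hP HU₁ h₂ hT hf₁ hε₁ hr₁).L : (𝔼 3) ≃L[ℝ] 𝔼 3) : (𝔼 3) →L[ℝ] 𝔼 3)‖ * R₀ < 2) :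
    c'.IsWallFrame HU₁.cone (U.frameC hf hεf hrf hκt hP HU₁ h₂ hT hf₁ hε₁ hr₁ hρ4 hfar hS) := by
  have h1 := HU₁.cone.spike
  have hκ₁ := h1.κ_pos
  have th := transport_hemispheres P.hA P.hB
  have hWf := isWallFrame_flipSpikedC h₂ hT HU₁.cone hf₁ hε₁ hr₁ th.1 th.2.1 th.2.2 P.hB (u := 1) ⟨zero_le_one, le_rfl⟩
  have hper := U.periodic_frameC hf hεf hrf hκt hP HU₁ h₂ hT hf₁ hε₁ hr₁ hρ4 hfar hS
  refine ⟨U.contDiff_frameC hf hεf hrf hκt hP HU₁ h₂ hT hf₁ hε₁ hr₁ hρ4 hfar hS, fun t _ ↦ hper t, ?_,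
    U.injOn_frameC hf hεf hrf hκt hP HU₁ h₂ hT hf₁ hε₁ hr₁ hρ4 hfar hS c'.alo, ?_, ?_⟩
  · rw [periodise_eq_of_periodic _ hper]; exact U.isRegularLoop_frameC hf hεf hrf hκt hP HU₁ h₂ hT hf₁ hε₁ hr₁ hρ4 hfar hS
  · -- agreement on the region: the region lies in the native zone, left of the chord zone
    intro s hlo hhi
    have hz := mem_zone_of_region h1 hlo hhi
    have hcm := c'.core_marks
    have hzc := c'.parLo_mem_core hκ₁ h1.seven_le_gapLo neg_seven_halves_mem
    have hsI : s ∈ Ico c'.alo (c'.alo + 1) := by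
      have := c'.parHi_mem_core hκ₁ h1.seven_le_gapHi neg_five_quarters_mem
      exact ⟨by linarith [hz.1, hzc.1], by linarith [hz.2, this.2]⟩
    have hoff : ∀ m : ℤ, liftInv P HU₁ s - m ∈ Ico b.alo (b.alo + 1) →
        liftInv P HU₁ s - m ∉ b.contentSet P.HU.cone.spike.κ_pos P.HU.cone.spike.seven_le_gapLo P.HU.cone.spike.seven_le_gapHi := by
      intro m hm hc
      rcases dichotomy P HU₁ hsI with h | ⟨ht, hc0⟩
      · exact h m hm hc
      · obtain ⟨hcore, hα⟩ := chordLift_mem_of_mem P HU₁ hc0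
        obtain ⟨-, hgt, -⟩ := chordZone_marks HU₁ hcore hα
        rw [chordLift_liftInv] at hgt
        linarith [hz.2]
    rw [U.frameC_eq_periodise hf hεf hrf hκt hP HU₁ h₂ hT hf₁ hε₁ hr₁ hρ4 hfar hS hoff, periodise_eq_self _ _ hsI]
    exact hWf.agree s hlo hhi
  · -- walls
    intro τ hτ hτs
    rcases dichotomy P HU₁ hτ with h | ⟨ht, hc⟩
    · rw [U.frameC_eq_periodise hf hεf hrf hκt hP HU₁ h₂ hT hf₁ hε₁ hr₁ hρ4 hfar hS h, periodise_eq_self _ _ hτ]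
      exact hWf.wall τ hτ hτs
    · obtain ⟨y, v, hv, hy, hy2, he⟩ := U.outOne_content hf hεf hrf hκt hP HU₁ h₂ hT hf₁ hε₁ hr₁ hρ4 hfar hS hL1 hL2 ht hc
      obtain ⟨hN, hlast, hfirst, -⟩ := reflect_near_chord (b₁ := c') h₂ hT hv hy hy2 (ne_zero_of_blowUp_near h₂ hv hy)
      right; right; right
      refine ⟨reflectLast 3 (psiN.symm y), ?_, hlast.le, fun _ ↦ hfirst⟩
      rw [← chordLift_liftInv P HU₁ τ, U.frameC_chordLift hf hεf hrf hκt hP HU₁ h₂ hT hf₁ hε₁ hr₁ hρ4 hfar hS, he]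

/-- **THE FRAME OF THE TRANSPORTED DATUM IS BEND-CLEAR.** [folklore] -/
theorem isBendClear_frameC
    (hL1 : ‖(((b'.frame hcross').symm : (𝔼 3) ≃L[ℝ] 𝔼 3) : (𝔼 3) →L[ℝ] 𝔼 3)‖ *
      (‖(((segData P hf hεf hrf hκt hP HU₁ h₂ hT hf₁ hε₁ hr₁).L : (𝔼 3) ≃L[ℝ] 𝔼 3) : (𝔼 3) →L[ℝ] 𝔼 3)‖ * R₀) ≤ κ₁ / 16)
    (hL2 : ‖chordO h₂‖ + ‖(((segData P hf hεf hrf hκt hP HU₁ h₂ hT hf₁ hε₁ hr₁).L : (𝔼 3) ≃L[ℝ] 𝔼 3) : (𝔼 3) →L[ℝ] 𝔼 3)‖ * R₀ < 2) :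
    c'.IsBendClear HU₁.cone (U.frameC hf hεf hrf hκt hP HU₁ h₂ hT hf₁ hε₁ hr₁ hρ4 hfar hS) := by
  have h1 := HU₁.cone.spike
  have th := transport_hemispheres P.hA P.hB
  intro τ hτ hτs
  rcases dichotomy P HU₁ hτ with h | ⟨ht, hc⟩
  · rw [U.frameC_eq_periodise hf hεf hrf hκt hP HU₁ h₂ hT hf₁ hε₁ hr₁ hρ4 hfar hS h, periodise_eq_self _ _ hτ]
    exact isBendClear_flipSpikedC h₂ hT HU₁.cone (u := 1) ⟨zero_le_one, le_rfl⟩ τ hτ hτs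
  · obtain ⟨y, v, hv, hy, hy2, he⟩ := U.outOne_content hf hεf hrf hκt hP HU₁ h₂ hT hf₁ hε₁ hr₁ hρ4 hfar hS hL1 hL2 ht hc
    obtain ⟨hN, -, -, hfar'⟩ := reflect_near_chord (b₁ := c') h₂ hT hv hy hy2 (ne_zero_of_blowUp_near h₂ hv hy)
    right
    refine ⟨reflectLast 3 (psiN.symm y), ?_, fun _ ↦ hfar'⟩
    rw [← chordLift_liftInv P HU₁ τ, U.frameC_chordLift hf hεf hrf hκt hP HU₁ h₂ hT hf₁ hε₁ hr₁ hρ4 hfar hS, he]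

/-! ### The frame knot and the bent knot of the transported datum -/

/-- **The frame knot of the transported frame is the reflected output knot reparametrised by the
inverse chord lift.** [folklore] -/
theorem frameKnot_frameC_eq
    (hW : c'.IsWallFrame HU₁.cone (U.frameC hf hεf hrf hκt hP HU₁ h₂ hT hf₁ hε₁ hr₁ hρ4 hfar hS)) :
    c'.frameKnot hW =
      (((U.outOneR hf hεf hrf hκt hP HU₁ h₂ hT hf₁ hε₁ hr₁ hρ4 hfar hS).isRegularLoop_curve).comp_lift (isLift_liftInv P HU₁)).toKnot
        (IsRegularLoop.simple_comp_lift (isLift_liftInv P HU₁) (U.outOneR hf hεf hrf hκt hP HU₁ h₂ hT hf₁ hε₁ hr₁ hρ4 hfar hS).simple_curve) := by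
  apply DFunLike.coe_injective
  funext x
  obtain ⟨t, rfl⟩ := exists_circlePt_eq x
  apply Subtype.ext
  rw [c'.coe_frameKnot_circlePt hW, IsRegularLoop.coe_toKnot_circlePt,
    periodise_eq_of_periodic _ (U.periodic_frameC hf hεf hrf hκt hP HU₁ h₂ hT hf₁ hε₁ hr₁ hρ4 hfar hS)]
  rfl

/-- **The frame knot of the transported frame is isotopic to the reflected output knot `R ∘ P₁`.**
[cite: HirschDT1976, Ch. 8, Thm. 8.1.3 (p. 180) and proof of Thm. 8.3.3 (p. 186)] -/
theorem isIsotopic_frameKnot_outOneR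
    (hW : c'.IsWallFrame HU₁.cone (U.frameC hf hεf hrf hκt hP HU₁ h₂ hT hf₁ hε₁ hr₁ hρ4 hfar hS)) :
    (c'.frameKnot hW).IsIsotopic (U.outOneR hf hεf hrf hκt hP HU₁ h₂ hT hf₁ hε₁ hr₁ hρ4 hfar hS) := by
  have h := (U.outOneR hf hεf hrf hκt hP HU₁ h₂ hT hf₁ hε₁ hr₁ hρ4 hfar hS).isRegularLoop_curve.isIsotopic_toKnot_comp_lift
    (isLift_liftInv P HU₁) (U.outOneR hf hεf hrf hκt hP HU₁ h₂ hT hf₁ hε₁ hr₁ hρ4 hfar hS).simple_curve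
  rw [Knot.toKnot_curve] at h
  rwa [U.frameKnot_frameC_eq hf hεf hrf hκt hP HU₁ h₂ hT hf₁ hε₁ hr₁ hρ4 hfar hS hW]

/-- **THE BENT KNOT OF THE TRANSPORTED DATUM** over the transported frame (unit scale `λ'`, bend
radius `r_A'` of `c'`). [folklore] -/
def bentC (hW : c'.IsWallFrame HU₁.cone (U.frameC hf hεf hrf hκt hP HU₁ h₂ hT hf₁ hε₁ hr₁ hρ4 hfar hS))
    {lam' rA' : ℝ} (hl' : lam' ∈ Ioc (0 : ℝ) 1) (hrA' : 0 < rA') : Knot :=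
  c'.bentKnot HU₁ hW hl' hrA' (transport_hemispheres P.hA P.hB).2.1 (transport_hemispheres P.hA P.hB).2.2

/-- **THE BENT KNOT OF THE TRANSPORTED DATUM IS ISOTOPIC TO `R ∘ P₁`.** [cite: HirschDT1976, Ch. 8 §1, Thm. 1.3] -/
theorem isIsotopic_bentC_outOneR (hW : c'.IsWallFrame HU₁.cone (U.frameC hf hεf hrf hκt hP HU₁ h₂ hT hf₁ hε₁ hr₁ hρ4 hfar hS))
    {lam' rA' : ℝ} (hl' : lam' ∈ Ioc (0 : ℝ) 1) (hrA' : 0 < rA') :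
    (U.bentC hf hεf hrf hκt hP HU₁ h₂ hT hf₁ hε₁ hr₁ hρ4 hfar hS hW hl' hrA').IsIsotopic
      (U.outOneR hf hεf hrf hκt hP HU₁ h₂ hT hf₁ hε₁ hr₁ hρ4 hfar hS) :=
  IsAmbientIsotopic.trans_holds
    (IsAmbientIsotopic.symm_holds (c'.isIsotopic_frameKnot_bentKnot HU₁ hW hl' hrA' (transport_hemispheres P.hA P.hB).2.1
      (transport_hemispheres P.hA P.hB).2.2))
    (U.isIsotopic_frameKnot_outOneR hf hεf hrf hκt hP HU₁ h₂ hT hf₁ hε₁ hr₁ hρ4 hfar hS hW)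

/-- **THE BENT KNOT OF THE TRANSPORTED DATUM IS ISOTOPIC TO `R ∘ K`** (through `R ∘ P₁ ≃ R ∘ bent_b
≃ R ∘ railKnot_b ≃ R ∘ K`, the last step granted the band fact). [cite: HirschDT1976, Ch. 8 §1, Thm. 1.3] -/
theorem isIsotopic_bentC_map (hW : c'.IsWallFrame HU₁.cone (U.frameC hf hεf hrf hκt hP HU₁ h₂ hT hf₁ hε₁ hr₁ hρ4 hfar hS))
    {lam' rA' : ℝ} (hl' : lam' ∈ Ioc (0 : ℝ) 1) (hrA' : 0 < rA') {L : Knot} (hL : (P.wallRef.bent U.hl₀ U.hrA).IsIsotopic L) :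
    (U.bentC hf hεf hrf hκt hP HU₁ h₂ hT hf₁ hε₁ hr₁ hρ4 hfar hS hW hl' hrA').IsIsotopic (L.map (reflectLastDiffeo 3)) := by
  refine IsAmbientIsotopic.trans_holds (U.isIsotopic_bentC_outOneR hf hεf hrf hκt hP HU₁ h₂ hT hf₁ hε₁ hr₁ hρ4 hfar hS hW hl' hrA') ?_
  rw [outOneR]
  exact SphereEmbedding.IsIsotopic.map_congr
    (IsAmbientIsotopic.trans_holds (IsAmbientIsotopic.symm_holds (U.isIsotopic_bent_outOne (segData P hf hεf hrf hκt hP HU₁ h₂ hT hf₁ hε₁ hr₁) rfl rfl rfl rfl (Psi_wallRef_host P hf hεf hrf hκt hP HU₁ h₂ hT hf₁ hε₁ hr₁) hρ4 hfar hS)) hL) _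

end WallRef.UnitScale

end FrameC

end BandData

end Literature.Topology.FourManifolds
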